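import Mathlib
import Summits.KontsevichZagierPeriods.KontsevichZagierPeriods.Theorems.SoloInformedTelescopeStepMaps
import HarnessLib
import HarnessLib.Audit

/-!
# SoloInformed — the Möbius telescope STEP in any dimension: representations and the five moves

Solo programme `solo-KontsevichZagierPeriods-informed`, session s45 (PART XVI, THEOREM XXXIII).
For a telescope datum `T` (`SoloInformedTelescopeStep`, `…StepMaps`): the representations
`R₁ = [D₁, f₁]`, `R₂ = [D, S]`, `A = R₂|_{D₁}`, `C = R₂|_{D₂}`, `B = [D₁, g]`, `R♯ = [D♯, f₁]`,
`V = [D, f_V]`, and the moves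

* (1b) `R₁ = A + B` (`f₁ = S + g`);
* (1a) `R₂ = A + C` (the wall `{xᵢ = ω}` is the zero set of `Xᵢ − ω ≠ 0`);
* (2) `B ≡ R♯` and `V ≡ C` along `Φ : xᵢ ↦ xᵢω` (Jacobian `ω`);
* (2) `V ≡ R♯` along the Möbius map `Ψ : xᵢ ↦ σ(xᵢ)` (Jacobian `ω(1−ω)(1−Qω²)/(1−Qω²xᵢ)²`).

**Main theorem** `SoloInformedTelDatum.telescope : of T.R1 − of T.R2 ∈ KZ.relations`. Only rules
(1a), (1b), (2) are used; every representation is absolutely convergent; the integrability of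
`B, R♯, V` is DERIVED (difference, transport along `Φ`), so the datum only asks for `R₁`, `R₂`.

References: Kontsevich–Zagier 2001 §1.2 [KontsevichZagier2001]; Yamamoto arXiv:1405.6499;
Kaneko–Yamamoto arXiv:1605.03117.
-/

noncomputable section

open MeasureTheory Set MvPolynomial
open Literature.ModelTheory.ExponentialFields Literature.NumberTheory.Transcendental
open Literature.NumberTheory.Transcendental.KZ

namespace Summit.KontsevichZagierPeriods.KontsevichZagierPeriods.Theorems

namespace SoloInformedTelDatum

variable {n : ℕ} (T : SoloInformedTelDatum n)

/-! ## 1. Pull-back identities along `Φ` and `Ψ` -/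

/-- Auxiliary (telescope step): `fS_Φ`. -/
theorem fS_Φ {x : Fin n → ℝ} (hx : x ∈ T.D) :
    T.fS (soloInformedPolyMap T.PΦ x) * |(soloInformedJacCLM T.PΦ x).det| = T.fV x := by
  rw [det_Φ, abs_of_pos (ω_pos hx), Φ_apply, fS_eq, cc_update, q_update, ω_update,
    Function.update_self, fV]
  have h1 := (cc_pos hx).ne'
  ring_nf

/-- Auxiliary (telescope step): `f1_Φ`. -/
theorem f1_Φ {x : Fin n → ℝ} (hx : x ∈ T.D) :
    T.f1 (soloInformedPolyMap T.PΦ x) * |(soloInformedJacCLM T.PΦ x).det| = T.g x := by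
  rw [det_Φ, abs_of_pos (ω_pos hx), Φ_apply, f1_eq, cc_update, q_update, ω_update,
    Function.update_self, g]
  ring

/-- Auxiliary (telescope step): `det_Ψ_pos`. -/
theorem det_Ψ_pos {x : Fin n → ℝ} (hx : x ∈ T.D) : 0 < (soloInformedRatJacCLM T.PΨ T.QΨ x).det := by
  rw [det_Ψ]
  exact div_pos (mul_pos (mul_pos (ω_pos hx) (by linarith [ω_lt_one hx])) (one_sub_qωω_pos hx))
    (pow_pos (one_sub_qωωxi_pos hx) 2)

/-- The Möbius pull-back: `f₁(Ψ x) · det J_Ψ(x) = f_V(x)`. -/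
theorem f1_Ψ {x : Fin n → ℝ} (hx : x ∈ T.D) :
    T.f1 (soloInformedRatMap T.PΨ T.QΨ x) * |(soloInformedRatJacCLM T.PΨ T.QΨ x).det| = T.fV x := by
  rw [abs_of_pos (T.det_Ψ_pos hx), det_Ψ, Ψ_apply, f1_eq, cc_update, q_update, ω_update,
    Function.update_self, fV]
  have hσ : 1 - T.q x * T.sig x =
      (1 - T.q x * T.ω x ^ 2) * (1 - T.q x * T.ω x * x T.i) / (1 - T.q x * T.ω x ^ 2 * x T.i) :=
    one_sub_q_sig hx
  rw [hσ]
  set a := 1 - T.q x * T.ω x ^ 2 * x T.i with ha_def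
  set b := 1 - T.q x * T.ω x ^ 2 with hb_def
  set e := 1 - T.q x * T.ω x * x T.i with he_def
  have ha : a ≠ 0 := (one_sub_qωωxi_pos hx).ne'
  have hb : b ≠ 0 := (one_sub_qωω_pos hx).ne'
  have he : e ≠ 0 := by rw [he_def]; linarith [one_sub_qxiω_pos hx]
  have hc : T.cc x ≠ 0 := (cc_pos hx).ne'
  have hw : (1 - T.ω x) ≠ 0 := by linarith [ω_lt_one hx]
  have h2 : (1 - T.q x * x T.i * T.ω x ^ 2) = a := by rw [ha_def]; ring
  have h3 : (1 - T.q x * x T.i * T.ω x) = e := by rw [he_def]; ring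
  rw [h2, h3]
  field_simp

/-! ## 2. The representations -/

/-- **`R₁ = [D₁, 1/(C(1 − Qxᵢ)(1 − ω))]`.** -/
def R1 : IntegralRep n where
  domain := T.D1
  integrand := T.f1
  isSemialgebraic_domain := T.isSemialgebraic_D1
  isSemialgebraicFunOn_integrand :=
    soloInformed_isSemialgebraicFunOn_quot T.isSemialgebraic_D1 1
      (T.C * (1 - T.Q * X T.i) * (1 - T.Ω)) _
      (fun x hx => by
        simpa [cc, q, ω] using (mul_pos (mul_pos (cc_pos hx.1) (one_sub_qxi_pos hx.1))
          (by linarith [ω_lt_one hx.1] : (0:ℝ) < 1 - T.ω x)).ne')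
      fun x _ => by simp [f1_eq, cc, q, ω]
  integrableOn := T.integrableOn_F1

/-- **`R₂ = [D, 1/(C(1 − Qxᵢ)(1 − Qxᵢω))]`.** -/
def R2 : IntegralRep n where
  domain := T.D
  integrand := T.fS
  isSemialgebraic_domain := T.isSemialgebraic_D
  isSemialgebraicFunOn_integrand :=
    soloInformed_isSemialgebraicFunOn_quot T.isSemialgebraic_D 1
      (T.C * (1 - T.Q * X T.i) * (1 - T.Q * X T.i * T.Ω)) _
      (fun x hx => by
        simpa [cc, q, ω] using (mul_pos (mul_pos (cc_pos hx) (one_sub_qxi_pos hx))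
          (one_sub_qxiω_pos hx)).ne')
      fun x _ => by simp [fS_eq, cc, q, ω]
  integrableOn := T.integrableOn_FS

/-- `A = R₂|_{D₁}`. -/
def A : IntegralRep n := T.R2.restrict T.D1 T.isSemialgebraic_D1 T.D1_subset
/-- `C = R₂|_{D₂}`. -/
def Cr : IntegralRep n := T.R2.restrict T.D2 T.isSemialgebraic_D2 T.D2_subset

/-- Auxiliary (telescope step): `integrableOn_g`. -/
theorem integrableOn_g : IntegrableOn T.g T.D1 := by
  have h : IntegrableOn (fun x => T.f1 x - T.fS x) T.D1 :=
    T.integrableOn_F1.sub (T.integrableOn_FS.mono_set T.D1_subset)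
  refine h.congr_fun (fun x hx => ?_) T.measurableSet_D1
  show T.f1 x - T.fS x = T.g x
  rw [f1_eq_fS_add_g hx.1]
  ring

/-- `B = [D₁, g]`. -/
def B : IntegralRep n where
  domain := T.D1
  integrand := T.g
  isSemialgebraic_domain := T.isSemialgebraic_D1
  isSemialgebraicFunOn_integrand :=
    soloInformed_isSemialgebraicFunOn_quot T.isSemialgebraic_D1 T.Ω
      (T.C * (1 - T.Q * X T.i * T.Ω) * (1 - T.Ω)) _
      (fun x hx => by
        simpa [cc, q, ω] using (mul_pos (mul_pos (cc_pos hx.1) (one_sub_qxiω_pos hx.1))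
          (by linarith [ω_lt_one hx.1] : (0:ℝ) < 1 - T.ω x)).ne')
      fun x _ => by simp [g, cc, q, ω]
  integrableOn := T.integrableOn_g

/-- Auxiliary (telescope step): `integrableOn_f1_Ds`. -/
theorem integrableOn_f1_Ds : IntegrableOn T.f1 T.Ds := by
  rw [← image_Φ_D1]
  exact (soloInformed_integrableOn_image_polyMap_iff T.PΦ T.measurableSet_D1
    (T.injOn_Φ.mono T.D1_subset) T.f1).2
    (T.integrableOn_g.congr_fun (fun x hx => by rw [← T.f1_Φ hx.1, mul_comm]) T.measurableSet_D1)

/-- `R♯ = [D♯, f₁]` (the `R₁`-integrand on the thin domain; integrable by transport along `Φ`). -/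
def Rs : IntegralRep n where
  domain := T.Ds
  integrand := T.f1
  isSemialgebraic_domain := T.isSemialgebraic_Ds
  isSemialgebraicFunOn_integrand :=
    soloInformed_isSemialgebraicFunOn_quot T.isSemialgebraic_Ds 1
      (T.C * (1 - T.Q * X T.i) * (1 - T.Ω)) _
      (fun x hx => by
        simpa [cc, q, ω] using (mul_pos (mul_pos (cc_pos hx.1) (one_sub_qxi_pos hx.1))
          (by linarith [ω_lt_one hx.1] : (0:ℝ) < 1 - T.ω x)).ne')
      fun x _ => by simp [f1_eq, cc, q, ω]
  integrableOn := T.integrableOn_f1_Ds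

/-- Auxiliary (telescope step): `integrableOn_fV`. -/
theorem integrableOn_fV : IntegrableOn T.fV T.D := by
  have h := (soloInformed_integrableOn_image_polyMap_iff T.PΦ T.measurableSet_D T.injOn_Φ T.fS).1
    (by rw [image_Φ_D]; exact T.integrableOn_FS.mono_set T.D2_subset)
  exact h.congr_fun (fun x hx => by rw [← T.fS_Φ hx, mul_comm]) T.measurableSet_D

/-- `V = [D, ω/(C(1 − Qxᵢω)(1 − Qxᵢω²))]` (integrable by transport along `Φ`). -/
def V : IntegralRep n where
  domain := T.D
  integrand := T.fV
  isSemialgebraic_domain := T.isSemialgebraic_D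
  isSemialgebraicFunOn_integrand :=
    soloInformed_isSemialgebraicFunOn_quot T.isSemialgebraic_D T.Ω
      (T.C * (1 - T.Q * X T.i * T.Ω) * (1 - T.Q * X T.i * T.Ω ^ 2)) _
      (fun x hx => by
        simpa [cc, q, ω] using (mul_pos (mul_pos (cc_pos hx) (one_sub_qxiω_pos hx))
          (one_sub_qxiωω_pos hx)).ne')
      fun x _ => by simp [fV, cc, q, ω]
  integrableOn := T.integrableOn_fV

/-! ## 3. The five moves -/

/-- **(1b)** `[R₁] − [A] − [B] ∈ relations`. -/
theorem move1 : of T.R1 - of T.A - of T.B ∈ relations :=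
  integrandAddRel_subset_relations ⟨n, T.R1, T.A, T.B, rfl, rfl,
    fun _ hx => f1_eq_fS_add_g hx.1, rfl⟩

/-- The two pieces of `R₂`. -/
def pieces : Fin 2 → IntegralRep n := ![T.A, T.Cr]

/-- `Xᵢ − ω` is a non-zero polynomial. -/
theorem X_sub_Ω_ne : (X T.i - T.Ω : MvPolynomial (Fin n) ℚ) ≠ 0 := fun h => by
  have hv : T.i ∈ (X T.i : MvPolynomial (Fin n) ℚ).vars := by simp [vars_X]
  rw [sub_eq_zero.1 h] at hv
  exact T.vars_Ω hv

/-- The wall `D \ (D₁ ∪ D₂) ⊆ {xᵢ = ω}` is null. -/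
theorem wall_null :
    volume (T.D \ ⋃ j ∈ (Finset.univ : Finset (Fin 2)), (T.pieces j).domain) = 0 := by
  refine soloInformed_volume_eq_zero_of_subset_zeroSet (X T.i - T.Ω) T.X_sub_Ω_ne fun x hx => ?_
  have hnot := hx.2
  simp only [Finset.mem_univ, iUnion_true, mem_iUnion, not_exists] at hnot
  have h0 : ¬ T.ω x < x T.i := fun hlt => hnot 0 ⟨hx.1, hlt⟩
  have h1 : ¬ x T.i < T.ω x := fun hlt => hnot 1 ⟨hx.1, hlt⟩
  have heq : x T.i = T.ω x := le_antisymm (not_lt.1 h0) (not_lt.1 h1)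
  simp [ω] at heq
  simp [heq]

/-- **(1a)** `[R₂] − ([A] + [C]) ∈ relations`. -/
theorem move2 : of T.R2 - (of T.A + of T.Cr) ∈ relations := by
  have h := of_sub_sum_of_mem_relations_of_subset (Finset.univ : Finset (Fin 2)) T.R2 T.pieces
    (fun j _ => by fin_cases j <;> exact inter_subset_left)
    (fun j _ => by fin_cases j <;> exact fun _ _ => rfl) T.wall_null
    (fun j _ j' _ hjj' => by
      fin_cases j <;> fin_cases j'
      · exact (hjj' rfl).elim
      · exact disjoint_left.2 fun x (hx : x ∈ T.D1) (hx' : x ∈ T.D2) =>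
          lt_asymm (show T.ω x < x T.i from hx.2) (show x T.i < T.ω x from hx'.2)
      · exact disjoint_left.2 fun x (hx : x ∈ T.D2) (hx' : x ∈ T.D1) =>
          lt_asymm (show x T.i < T.ω x from hx.2) (show T.ω x < x T.i from hx'.2)
      · exact (hjj' rfl).elim)
  simpa [pieces, Fin.sum_univ_two] using h

/-- **(2)** `[B] − [R♯] ∈ relations` along `Φ` (`D₁ → D♯`, Jacobian `ω`). -/
theorem move3 : of T.B - of T.Rs ∈ relations :=
  soloInformed_of_sub_of_mem_relations_polyMapCLM T.PΦ T.B T.Rs (T.injOn_Φ.mono T.D1_subset)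
    T.image_Φ_D1.symm fun _ hx => (T.f1_Φ hx.1).symm

/-- **(2)** `[V] − [C] ∈ relations` along `Φ` (`D → D₂`, Jacobian `ω`). -/
theorem move4 : of T.V - of T.Cr ∈ relations :=
  soloInformed_of_sub_of_mem_relations_polyMapCLM T.PΦ T.V T.Cr T.injOn_Φ T.image_Φ_D.symm
    fun _ hx => (T.fS_Φ hx).symm

/-- **(2), the Möbius move** `[V] − [R♯] ∈ relations` along `Ψ` (`D → D♯`). -/
theorem move5 : of T.V - of T.Rs ∈ relations :=
  soloInformed_of_sub_of_mem_relations_ratMap T.PΨ T.QΨ T.V T.Rs (fun j _ hx => T.QΨ_ne hx j)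
    T.injOn_Ψ T.image_Ψ.symm fun _ hx => (T.f1_Ψ hx).symm

/-- **THE TELESCOPE STEP (THEOREM XXXIII, KERNEL in every dimension).**
`[D ∩ {ω < xᵢ}, 1/(C(1−Qxᵢ)(1−ω))] − [D, 1/(C(1−Qxᵢ)(1−Qxᵢω))] ∈ KZ.relations`, by the five moves:
`(R₁−A−B) + (B−R♯) − (V−R♯) + (V−C) − (R₂−A−C)`. [Kontsevich–Zagier 2001 §1.2, rules (1),(2)] -/
theorem telescope : of T.R1 - of T.R2 ∈ relations := by
  have h : of T.R1 - of T.R2 = (of T.R1 - of T.A - of T.B) + (of T.B - of T.Rs)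
      - (of T.V - of T.Rs) + (of T.V - of T.Cr) - (of T.R2 - (of T.A + of T.Cr)) := by abel
  rw [h]
  exact relations.sub_mem (relations.add_mem (relations.sub_mem (relations.add_mem T.move1 T.move3)
    T.move5) T.move4) T.move2

/-- The step as an equivalence of representations. -/
theorem telescope_equivalent : Equivalent T.R1 T.R2 := T.telescope

/-- Auxiliary (telescope step): `R1_domain`. -/
@[simp] theorem R1_domain : T.R1.domain = T.D ∩ {x | T.ω x < x T.i} := rfl
/-- Auxiliary (telescope step): `R1_integrand`. -/
@[simp] theorem R1_integrand : T.R1.integrand = T.f1 := rfl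
/-- Auxiliary (telescope step): `R2_domain`. -/
@[simp] theorem R2_domain : T.R2.domain = T.D := rfl
/-- Auxiliary (telescope step): `R2_integrand`. -/
@[simp] theorem R2_integrand : T.R2.integrand = T.fS := rfl

end SoloInformedTelDatum

end Summit.KontsevichZagierPeriods.KontsevichZagierPeriods.Theorems
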